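import Summits.AtomisticToContinuum.Crystallization.Theorems.PricedLinkCensusStackingHingeOfSupportCore
import Summits.AtomisticToContinuum.Crystallization.Theorems.PricedLinkCensusStackingHingeOfExactStars
import Summits.AtomisticToContinuum.Crystallization.Theorems.PricedLinkCensusStackingHingeSimilarStarNormalisationLocal
import Summits.AtomisticToContinuum.Crystallization.Theorems.PricedLinkCensusStackingHingeSimilarStarNormalisationCompact

/-!
# Route `PricedLinkCensus`, crux `StackingHinge` (stmt-AtomisticToContinuum-14993), line `Sketch`:
# stub `stub_similarStarNormalisation` (V3) — SIMILAR EXACT STARS ⇒ ONE DILATION AND ABSOLUTE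
# EXACT STARS

Deterministic geometry, no potential, no measure.  Let `(a₀, h₀)` be in the parameter box,
`S ∋ 0` `δ`-separated with every point SLP-good and bond-shell-good, and suppose that at EVERY
`x ∈ S` and every tolerance `1/(n+1)` the root star of `S − x` (its bonded neighbours, radius
`1.01 · nn_x`) is two-way `(t/(n+1))`-matched to `t · A(F)` for some rotation `A`, dilation `t > 0`
and `F ∈ {refStar a₀ h₀, a₀ • fccKissingPattern}`.  Then there is ONE `t > 0` with `S = t • S'`,
`0 ∈ S'`, and every `x ∈ S'` has the ABSOLUTE exact two-type star of line `Sketch`: the punctured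
`5/4`-ball of `S' − x` EQUALS `A_x '' refStar a₀ h₀` or `A_x '' (a₀ • fccKissingPattern)`
(`stub_similarStarNormalisation`, registered signature verbatim).

Proof (support files `…SimilarStarNormalisation{Pattern,Compact,Star,Bond,Local}`).
1. COMPACTNESS (`exact_of_matched_two`): at each `x` the root star is finite with norms in
   `[nn_x, 1.01 nn_x]`, so it EQUALS `T x • A x '' F x` for some rotation, dilation and type.
2. SCALE CONSTANCY ALONG BONDS (`scale_eq_of_bonded`) and the EMPTY ANNULUS up to `5/4 · T x`
   (`dist_le_of_dist_le_scale`), from the landed local Barlow structure.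
3. GLOBALISATION: the bond component `C` of `0` has constant scale `t = T 0`; the normalised
   component `t⁻¹ C` has exact absolute `5/4`-stars everywhere, so by the landed rigidity theorem
   `PricedHcpWindowsExactStars.exactStarRigidity` (p164240, p168022) it is a rotated Barlow stacking
   `B '' barlowStacking a₀ h s'`, `h ∈ {h₀, a₀√(2/3)}`, whose covering radius (`< 1.057 · a₀` after
   the axial stretch from the ideal stacking, `exists_mem_barlowStacking_dist_lt`) is below the
   bond-shell gap `1.07/1.01 · a₀`: every point of `S` is bonded to a point of `C`, so `C = S`.

The global `hcpE`-minimality hypothesis of the registered signature is not used.  All `[folklore]`.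
-/

noncomputable section

namespace Summit.AtomisticToContinuum.Crystallization.Theorems.PricedHcpWindowsSimilarStarNormalisation

open Literature.MathematicalPhysics.StatisticalMechanics Literature.Geometry.DiscreteGeometry
open Summit.AtomisticToContinuum.Crystallization.Theorems.PalmUnimodularRigidity.LayeredLawsSelectHcp
open Summit.AtomisticToContinuum.Crystallization.Theorems.PricedHcpWindowsHcpLocalExactRigid
  (mem_translate_iff)
open Summit.AtomisticToContinuum.Crystallization.Theorems.PricedHcpWindowsRelaxedStarRigidity
  (axialStretch axialStretch_comp axialStretch_one axialStretch_sub norm_axialStretch_sq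
    axialStretch_image_barlowStacking exists_mem_barlowStacking_dist_lt)
open Summit.AtomisticToContinuum.Crystallization.Theorems.PricedHcpWindowsExactStars
  (exactStarRigidity)

/-! ## Elementary tools -/

/-- **The stretch is Lipschitz**: `‖axialStretch g v‖ ≤ G ‖v‖` for `0 ≤ g ≤ G`, `1 ≤ G`. [folklore] -/
theorem norm_axialStretch_le_mul {g G : ℝ} (hg : 0 ≤ g) (hgG : g ≤ G) (hG : 1 ≤ G)
    (v : EuclideanSpace ℝ (Fin 3)) : ‖axialStretch g v‖ ≤ G * ‖v‖ := by
  have hsq : ‖axialStretch g v‖ ^ 2 ≤ (G * ‖v‖) ^ 2 := by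
    rw [norm_axialStretch_sq, mul_pow, norm_sq_eq_three]
    have h1 : g ^ 2 ≤ G ^ 2 := pow_le_pow_left₀ hg hgG 2
    have h2 : 1 ≤ G ^ 2 := by nlinarith
    nlinarith [sq_nonneg (v 0), sq_nonneg (v 1), sq_nonneg (v 2), mul_le_mul_of_nonneg_right h1 (sq_nonneg (v 2))]
  exact le_of_pow_le_pow_left₀ two_ne_zero (by positivity) hsq

/-- **Covering radius of a stretched ideal stacking**: every point of `ℝ³` is within `G · a` of
`barlowStacking a (g · a√(2/3)) s` when `0 < g ≤ G`, `1 ≤ G`. [folklore] -/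
theorem exists_mem_barlowStacking_dist_lt_mul {a g G : ℝ} (ha : 0 < a) (hg : 0 < g) (hgG : g ≤ G)
    (hG : 1 ≤ G) (s : ℤ → ℤ) (p : EuclideanSpace ℝ (Fin 3)) :
    ∃ z ∈ barlowStacking a (g * (a * Real.sqrt (2 / 3))) s, dist p z < G * a := by
  obtain ⟨z, hz, hd⟩ := exists_mem_barlowStacking_dist_lt ha s (axialStretch g⁻¹ p)
  refine ⟨axialStretch g z, ?_, ?_⟩
  · rw [← axialStretch_image_barlowStacking]
    exact ⟨z, hz, rfl⟩
  · have hp : axialStretch g (axialStretch g⁻¹ p) = p := by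
      rw [axialStretch_comp, mul_inv_cancel₀ hg.ne', axialStretch_one]
    calc dist p (axialStretch g z)
        = ‖axialStretch g (axialStretch g⁻¹ p - z)‖ := by rw [axialStretch_sub, hp, dist_eq_norm]
      _ ≤ G * ‖axialStretch g⁻¹ p - z‖ := norm_axialStretch_le_mul hg.le hgG hG _
      _ < G * a := by
          rw [← dist_eq_norm]
          exact mul_lt_mul_of_pos_left hd (by linarith)

/-- **Bonded sets from root stars**: if the root star of `S − x` is the similar copy
`t • A '' F`, then the bonded neighbours of `x` in `S` are `x + t • A '' F`. [folklore] -/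
theorem bonded_eq_of_rootStar_eq {S : Set (EuclideanSpace ℝ (Fin 3))} {x : EuclideanSpace ℝ (Fin 3)}
    {t : ℝ} {A : EuclideanSpace ℝ (Fin 3) ≃ₗᵢ[ℝ] EuclideanSpace ℝ (Fin 3)}
    {F : Set (EuclideanSpace ℝ (Fin 3))}
    (hR : {y : EuclideanSpace ℝ (Fin 3) | y ∈ ((fun p : EuclideanSpace ℝ (Fin 3) => p - x) '' S) ∧
      y ≠ 0 ∧ ‖y‖ ≤ 101 / 100 * Metric.infDist (0 : EuclideanSpace ℝ (Fin 3))
        (((fun p : EuclideanSpace ℝ (Fin 3) => p - x) '' S) \ {0})} = (fun v => t • A v) '' F) :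
    {y : EuclideanSpace ℝ (Fin 3) | y ∈ S ∧ y ≠ x ∧
      dist x y ≤ 101 / 100 * Metric.infDist x (S \ {x})} = (fun v => x + t • A v) '' F := by
  rw [infDist_translate] at hR
  ext y
  have key : (y ∈ S ∧ y ≠ x ∧ dist x y ≤ 101 / 100 * Metric.infDist x (S \ {x})) ↔
      y - x ∈ {y : EuclideanSpace ℝ (Fin 3) | y ∈ ((fun p : EuclideanSpace ℝ (Fin 3) => p - x) '' S) ∧
        y ≠ 0 ∧ ‖y‖ ≤ 101 / 100 * Metric.infDist x (S \ {x})} := by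
    simp only [Set.mem_setOf_eq, mem_translate_iff, add_sub_cancel, sub_ne_zero, dist_eq_norm,
      norm_sub_rev]
  rw [Set.mem_setOf_eq, key, hR]
  constructor
  · rintro ⟨v, hv, he⟩
    have he' : t • A v = y - x := he
    refine ⟨v, hv, ?_⟩
    show x + t • A v = y
    rw [he', add_sub_cancel]
  · rintro ⟨v, hv, rfl⟩
    refine ⟨v, hv, ?_⟩
    show t • A v = x + t • A v - x
    rw [add_sub_cancel_left]

/-! ## Globalisation -/

section Global

variable {a h : ℝ} (ha₁ : 189 / 200 ≤ a) (ha₂ : a ≤ 199 / 200) (hh₁ : 77 / 100 ≤ h)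
  (hh₂ : h ≤ 163 / 200) {δ : ℝ} (hδ : 0 < δ) {S : Set (EuclideanSpace ℝ (Fin 3))}
  (h0 : (0 : EuclideanSpace ℝ (Fin 3)) ∈ S)
  (hsep : ∀ x ∈ S, ∀ y ∈ S, x ≠ y → δ ≤ dist x y)
  (hgood : ∀ x ∈ S, (∀ t r : ℝ, Metric.infDist x (S \ {x}) / 6 < t → r < 3 * Metric.infDist x (S \ {x}) → ∃ s : ℤ → ℤ, Literature.MathematicalPhysics.StatisticalMechanics.IsHaggSeq s ∧ ∃ g : EuclideanSpace ℝ (Fin 3) ≃ᵃⁱ[ℝ] EuclideanSpace ℝ (Fin 3), (∀ y ∈ S, dist x y ≤ r → ∃ z ∈ Literature.MathematicalPhysics.StatisticalMechanics.barlowStacking (Metric.infDist x (S \ {x})) (Metric.infDist x (S \ {x}) * Real.sqrt (2 / 3)) s, dist y (g z) ≤ t) ∧ (∀ z ∈ Literature.MathematicalPhysics.StatisticalMechanics.barlowStacking (Metric.infDist x (S \ {x})) (Metric.infDist x (S \ {x}) * Real.sqrt (2 / 3)) s, dist x (g z) ≤ r → ∃ y ∈ S, dist y (g z) ≤ t)) ∧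 ((∀ y ∈ S, y ≠ x → dist x y < 107 / 100 * Metric.infDist x (S \ {x}) → dist x y ≤ 101 / 100 * Metric.infDist x (S \ {x})) ∧ ∃ T : Finset (EuclideanSpace ℝ (Fin 3)), (↑T : Set (EuclideanSpace ℝ (Fin 3))) ⊆ {y : EuclideanSpace ℝ (Fin 3) | y ∈ S ∧ y ≠ x ∧ dist x y ≤ 101 / 100 * Metric.infDist x (S \ {x})} ∧ T.card = 12))
  {A : EuclideanSpace ℝ (Fin 3) → (EuclideanSpace ℝ (Fin 3) ≃ₗᵢ[ℝ] EuclideanSpace ℝ (Fin 3))}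
  {T : EuclideanSpace ℝ (Fin 3) → ℝ}
  {F : EuclideanSpace ℝ (Fin 3) → Set (EuclideanSpace ℝ (Fin 3))}
  (hT : ∀ x ∈ S, 0 < T x)
  (hF : ∀ x ∈ S, F x = (refStar a h : Set (EuclideanSpace ℝ (Fin 3))) ∨
    F x = (fun p : EuclideanSpace ℝ (Fin 3) => a • p) ''
      (fccKissingPattern : Set (EuclideanSpace ℝ (Fin 3))))
  (hstar : ∀ x ∈ S, {y : EuclideanSpace ℝ (Fin 3) | y ∈ S ∧ y ≠ x ∧
      dist x y ≤ 101 / 100 * Metric.infDist x (S \ {x})} = (fun v => x + T x • A x v) '' F x)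

include h0 in
/-- **The bond component of `0`** — the points reachable from `0` through bonds
`dist p q ≤ 1.01 nn_p`, `p, q ∈ S` — lies in `S`. [folklore] -/
theorem bondComp_subset : {z : EuclideanSpace ℝ (Fin 3) | Relation.ReflTransGen (fun p q : EuclideanSpace ℝ (Fin 3) =>
        p ∈ S ∧ q ∈ S ∧ q ≠ p ∧ dist p q ≤ 101 / 100 * Metric.infDist p (S \ {p})) 0 z} ⊆ S := by
  intro z hz
  induction hz with
  | refl => exact h0
  | tail _ hpq _ => exact hpq.2.1

omit hT hstar in
/-- The bond component is closed under bonds. [folklore] -/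
theorem mem_bondComp_of_bond {p q : EuclideanSpace ℝ (Fin 3)} (hp : p ∈ {z : EuclideanSpace ℝ (Fin 3) | Relation.ReflTransGen (fun p q : EuclideanSpace ℝ (Fin 3) =>
        p ∈ S ∧ q ∈ S ∧ q ≠ p ∧ dist p q ≤ 101 / 100 * Metric.infDist p (S \ {p})) 0 z}) (hpS : p ∈ S)
    (hq : q ∈ S) (hqp : q ≠ p) (hd : dist p q ≤ 101 / 100 * Metric.infDist p (S \ {p})) :
    q ∈ {z : EuclideanSpace ℝ (Fin 3) | Relation.ReflTransGen (fun p q : EuclideanSpace ℝ (Fin 3) =>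
        p ∈ S ∧ q ∈ S ∧ q ≠ p ∧ dist p q ≤ 101 / 100 * Metric.infDist p (S \ {p})) 0 z} :=
  Relation.ReflTransGen.tail hp ⟨hpS, hq, hqp, hd⟩

include ha₁ ha₂ hh₁ hh₂ hδ hsep hgood hT hF hstar in
/-- **The scale is constant on the bond component.** [folklore] -/
theorem scale_eq_of_mem_bondComp {z : EuclideanSpace ℝ (Fin 3)} (hz : z ∈ {z : EuclideanSpace ℝ (Fin 3) | Relation.ReflTransGen (fun p q : EuclideanSpace ℝ (Fin 3) =>
        p ∈ S ∧ q ∈ S ∧ q ≠ p ∧ dist p q ≤ 101 / 100 * Metric.infDist p (S \ {p})) 0 z}) : T z = T 0 := by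
  induction hz with
  | refl => rfl
  | tail _ hpq ih =>
    rw [← ih]
    exact scale_eq_of_bonded ha₁ ha₂ hh₁ hh₂ hδ hsep hgood hT hF hstar hpq.1 hpq.2.1 hpq.2.2.1 hpq.2.2.2

include ha₁ ha₂ hh₁ hh₂ hδ h0 hsep hgood hT hF hstar in
/-- **Exact absolute stars on the normalised component**: for `z` with `T 0 • z` in the bond
component `C` of `0`, the punctured `5/4`-ball of `(T 0)⁻¹ • C − z` is `A x '' F x`, `x = T 0 • z`.
[folklore] -/
theorem pball_normalised_eq {z : EuclideanSpace ℝ (Fin 3)} (hz : T 0 • z ∈ {z : EuclideanSpace ℝ (Fin 3) | Relation.ReflTransGen (fun p q : EuclideanSpace ℝ (Fin 3) =>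
        p ∈ S ∧ q ∈ S ∧ q ≠ p ∧ dist p q ≤ 101 / 100 * Metric.infDist p (S \ {p})) 0 z}) :
    {y : EuclideanSpace ℝ (Fin 3) | y ∈ ((fun p : EuclideanSpace ℝ (Fin 3) => p - z) ''
        {w : EuclideanSpace ℝ (Fin 3) | T 0 • w ∈ {z : EuclideanSpace ℝ (Fin 3) | Relation.ReflTransGen (fun p q : EuclideanSpace ℝ (Fin 3) =>
        p ∈ S ∧ q ∈ S ∧ q ≠ p ∧ dist p q ≤ 101 / 100 * Metric.infDist p (S \ {p})) 0 z}}) ∧ y ≠ 0 ∧ ‖y‖ ≤ 5 / 4} =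
      A (T 0 • z) '' F (T 0 • z) := by
  set t₀ := T 0 with ht₀_def
  have ht₀ : 0 < t₀ := hT 0 h0
  set x := t₀ • z with hx_def
  have hxS : x ∈ S := bondComp_subset h0 hz
  have hTx : T x = t₀ := scale_eq_of_mem_bondComp ha₁ ha₂ hh₁ hh₂ hδ hsep hgood hT hF hstar hz
  ext y
  simp only [Set.mem_setOf_eq, mem_translate_iff]
  constructor
  · rintro ⟨hq, hy0, hy⟩
    -- `q = x + t₀ y` is a point of `S` in the `5/4 · T x`-ball about `x`
    have hqS : x + t₀ • y ∈ S := by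
      have := bondComp_subset h0 hq
      rwa [smul_add] at this
    have hqx : x + t₀ • y ≠ x := by
      intro heq
      have : t₀ • y = 0 := by
        have h1 := congrArg (fun w => w - x) heq
        simpa using h1
      exact hy0 ((smul_eq_zero.1 this).resolve_left ht₀.ne')
    have hdq : dist x (x + t₀ • y) ≤ 5 / 4 * T x := by
      rw [dist_comm, dist_eq_norm, add_sub_cancel_left, norm_smul, Real.norm_of_nonneg ht₀.le, hTx]
      nlinarith
    have hb := dist_le_of_dist_le_scale ha₁ ha₂ hh₁ hh₂ hδ hsep hgood hT hF hstar hxS hqS hqx hdq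
    obtain ⟨v, hv, he⟩ := exists_strut_of_bonded hstar hxS hqS hqx hb
    refine ⟨v, hv, ?_⟩
    have h1 : T x • A x v = t₀ • y := add_left_cancel he
    rw [hTx] at h1
    exact smul_right_injective _ ht₀.ne' h1
  · rintro ⟨v, hv, rfl⟩
    obtain ⟨hS, hne, hd⟩ := mem_of_strut hstar hxS hv
    refine ⟨?_, ?_, ?_⟩
    · show t₀ • (z + A x v) ∈ {z : EuclideanSpace ℝ (Fin 3) | Relation.ReflTransGen (fun p q : EuclideanSpace ℝ (Fin 3) =>
        p ∈ S ∧ q ∈ S ∧ q ≠ p ∧ dist p q ≤ 101 / 100 * Metric.infDist p (S \ {p})) 0 z}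
      rw [smul_add, ← hx_def, ← hTx]
      exact mem_bondComp_of_bond hz hxS hS hne hd
    · intro h0'
      exact ne_zero_of_mem ha₁ ha₂ hh₁ hh₂ (hF x hxS) hv ((A x).map_eq_zero_iff.1 h0')
    · rw [LinearIsometryEquiv.norm_map]
      exact (norm_bounds ha₁ ha₂ hh₁ hh₂ (hF x hxS) hv).2

include ha₁ ha₂ hh₁ hh₂ hδ h0 hsep hgood hT hF hstar in
/-- **The bond component is everything**: the normalised component is an exact rotated Barlow
stacking (`exactStarRigidity`), whose covering radius is below the bond-shell gap, so every
point of `S` is bonded to a point of the component. [folklore] -/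
theorem mem_bondComp {y : EuclideanSpace ℝ (Fin 3)} (hy : y ∈ S) : y ∈ {z : EuclideanSpace ℝ (Fin 3) | Relation.ReflTransGen (fun p q : EuclideanSpace ℝ (Fin 3) =>
        p ∈ S ∧ q ∈ S ∧ q ≠ p ∧ dist p q ≤ 101 / 100 * Metric.infDist p (S \ {p})) 0 z} := by
  set t₀ := T 0 with ht₀_def
  have ht₀ : 0 < t₀ := hT 0 h0
  have ha : 0 < a := by linarith
  -- the normalised component is an exact rotated Barlow stacking
  set S₁ : Set (EuclideanSpace ℝ (Fin 3)) := {w | t₀ • w ∈ {z : EuclideanSpace ℝ (Fin 3) | Relation.ReflTransGen (fun p q : EuclideanSpace ℝ (Fin 3) =>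
        p ∈ S ∧ q ∈ S ∧ q ≠ p ∧ dist p q ≤ 101 / 100 * Metric.infDist p (S \ {p})) 0 z}} with hS₁_def
  have h0₁ : (0 : EuclideanSpace ℝ (Fin 3)) ∈ S₁ := by
    show t₀ • (0 : EuclideanSpace ℝ (Fin 3)) ∈ {z : EuclideanSpace ℝ (Fin 3) | Relation.ReflTransGen (fun p q : EuclideanSpace ℝ (Fin 3) =>
        p ∈ S ∧ q ∈ S ∧ q ≠ p ∧ dist p q ≤ 101 / 100 * Metric.infDist p (S \ {p})) 0 z}
    rw [smul_zero]; exact Relation.ReflTransGen.refl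
  have hstars : ∀ z ∈ S₁, ∃ B : EuclideanSpace ℝ (Fin 3) ≃ₗᵢ[ℝ] EuclideanSpace ℝ (Fin 3),
      ({y : EuclideanSpace ℝ (Fin 3) | y ∈ ((fun p : EuclideanSpace ℝ (Fin 3) => p - z) '' S₁) ∧
          y ≠ 0 ∧ ‖y‖ ≤ 5 / 4} = B '' (refStar a h : Set (EuclideanSpace ℝ (Fin 3))) ∨
        {y : EuclideanSpace ℝ (Fin 3) | y ∈ ((fun p : EuclideanSpace ℝ (Fin 3) => p - z) '' S₁) ∧
          y ≠ 0 ∧ ‖y‖ ≤ 5 / 4} = B '' ((fun p : EuclideanSpace ℝ (Fin 3) => a • p) ''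
            (fccKissingPattern : Set (EuclideanSpace ℝ (Fin 3))))) := by
    intro z hz
    have heq := pball_normalised_eq ha₁ ha₂ hh₁ hh₂ hδ h0 hsep hgood hT hF hstar hz
    refine ⟨A (t₀ • z), ?_⟩
    rcases hF (t₀ • z) (bondComp_subset h0 hz) with hFz | hFz
    · left; rw [heq, hFz]
    · right; rw [heq, hFz]
  obtain ⟨B, hh, hhh, s', -, hS₁⟩ := exactStarRigidity a h ha₁ ha₂ hh₁ hh₂ S₁ h0₁ hstars
  -- the layer spacing as a stretch of the ideal one, with stretch factor `≤ 1.057`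
  set g : ℝ := hh / (a * Real.sqrt (2 / 3)) with hg_def
  have h23 : 0 < Real.sqrt (2 / 3) := Real.sqrt_pos.2 (by norm_num)
  have h23sq : Real.sqrt (2 / 3) ^ 2 = 2 / 3 := Real.sq_sqrt (by norm_num)
  have hden : 0 < a * Real.sqrt (2 / 3) := mul_pos ha h23
  have hhh0 : 0 < hh := by
    rcases hhh with rfl | rfl
    · linarith
    · exact hden
  have hg : 0 < g := div_pos hhh0 hden
  have hgG : g ≤ 1057 / 1000 := by
    rw [hg_def, div_le_iff₀ hden]
    rcases hhh with rfl | rfl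
    · have hsq : hh ^ 2 ≤ (1057 / 1000 * (a * Real.sqrt (2 / 3))) ^ 2 := by
        rw [mul_pow, mul_pow, h23sq]; nlinarith
      exact le_of_pow_le_pow_left₀ two_ne_zero (by positivity) hsq
    · nlinarith
  have hstack : barlowStacking a hh s' = barlowStacking a (g * (a * Real.sqrt (2 / 3))) s' := by
    rw [hg_def, div_mul_cancel₀ hh hden.ne']
  -- a point of the component near `y`
  obtain ⟨z₂, hz₂, hd⟩ := exists_mem_barlowStacking_dist_lt_mul ha hg hgG (by norm_num) s'
    (B.symm (t₀⁻¹ • y))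
  rw [← hstack] at hz₂
  have hBz₂ : B z₂ ∈ S₁ := by rw [hS₁]; exact ⟨z₂, hz₂, rfl⟩
  set p := t₀ • B z₂ with hp_def
  have hpC : p ∈ {z : EuclideanSpace ℝ (Fin 3) | Relation.ReflTransGen (fun p q : EuclideanSpace ℝ (Fin 3) =>
        p ∈ S ∧ q ∈ S ∧ q ≠ p ∧ dist p q ≤ 101 / 100 * Metric.infDist p (S \ {p})) 0 z} := hBz₂
  have hpS : p ∈ S := bondComp_subset h0 hpC
  have hdyp : dist p y < t₀ * (1057 / 1000 * a) := by
    have hy' : y = t₀ • B (B.symm (t₀⁻¹ • y)) := by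
      rw [LinearIsometryEquiv.apply_symm_apply, smul_inv_smul₀ ht₀.ne']
    rw [hp_def, hy', dist_smul₀, Real.norm_of_nonneg ht₀.le, LinearIsometryEquiv.dist_map, dist_comm]
    exact mul_lt_mul_of_pos_left hd ht₀
  by_cases hyp : y = p
  · rw [hyp]; exact hpC
  -- the gap at `p`: `y` is bonded to `p`
  have hTp : T p = t₀ := scale_eq_of_mem_bondComp ha₁ ha₂ hh₁ hh₂ hδ hsep hgood hT hF hstar hpC
  obtain ⟨v₁, hv₁, hv₁a⟩ := exists_norm_eq ha₁ (hF p hpS)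
  have hnn : T p * a ≤ 101 / 100 * Metric.infDist p (S \ {p}) := by
    have := (strut_bounds hT hstar hpS hv₁).2; rwa [hv₁a] at this
  rw [hTp] at hnn
  have hlt : dist p y < 107 / 100 * Metric.infDist p (S \ {p}) := by nlinarith
  have hle := (hgood p hpS).2.1 y hy hyp hlt
  exact mem_bondComp_of_bond hpC hpS hy hyp hle

end Global

/-! ## The registered stub -/

/-- **V3 `stub_similarStarNormalisation`** (SIMILAR EXACT STARS ⇒ ONE DILATION AND ABSOLUTE EXACT
STARS; registered signature of line `Sketch`, skeleton v37, verbatim).  For `(a₀, h₀)` in the box,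
`S ∋ 0` `δ`-separated with every point SLP-good and bond-shell-good, if at every `x ∈ S` and every
tolerance `1/(n+1)` the root star of `S − x` is two-way `(t/(n+1))`-matched to a similar copy
`t · A(F)` of a two-type reference star, then `S = t • S'` for ONE `t > 0` with `0 ∈ S'` and every
point of `S'` having an exact absolute two-type star in its punctured `5/4`-ball.  See the module
docstring for the proof; the `hcpE`-minimality hypothesis is not needed. [folklore] -/
theorem stub_similarStarNormalisation : ∀ a₀ h₀ : ℝ, 189 / 200 ≤ a₀ → a₀ ≤ 199 / 200 → 77 / 100 ≤ h₀ → h₀ ≤ 163 / 200 → (∀ a h : ℝ, 0 < a → 0 < h → Summit.AtomisticToContinuum.Crystallization.Theorems.PalmUnimodularRigidity.LayeredLawsSelectHcp.hcpE a₀ h₀ ≤ Summit.AtomisticToContinuum.Crystallization.Theorems.PalmUnimodularRigidity.LayeredLawsSelectHcp.hcpE a h) → ∀ δ : ℝ, 0 < δ → ∀ S : Set (EuclideanSpace ℝ (Fin 3)), (0 : EuclideanSpace ℝ (Fin 3)) ∈ S → (∀ x ∈ S, ∀ y ∈ S, x ≠ y → δ ≤ dist x y) → (∀ x ∈ S, (∀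 t r : ℝ, Metric.infDist x (S \ {x}) / 6 < t → r < 3 * Metric.infDist x (S \ {x}) → ∃ s : ℤ → ℤ, Literature.MathematicalPhysics.StatisticalMechanics.IsHaggSeq s ∧ ∃ g : EuclideanSpace ℝ (Fin 3) ≃ᵃⁱ[ℝ] EuclideanSpace ℝ (Fin 3), (∀ y ∈ S, dist x y ≤ r → ∃ z ∈ Literature.MathematicalPhysics.StatisticalMechanics.barlowStacking (Metric.infDist x (S \ {x})) (Metric.infDist x (S \ {x}) * Real.sqrt (2 / 3)) s, dist y (g z) ≤ t) ∧ (∀ z ∈ Literature.MathematicalPhysics.StatisticalMechanics.barlowStacking (Metric.infDist x (S \ {x})) (Metric.infDist x (S \ {x}) * Real.sqrt (2 / 3)) s, dist x (g z) ≤ r → ∃ y ∈ S, dist y (g z) ≤ t)) ∧ ((∀ y ∈ S, y ≠ x → dist x y < 107 / 100 * Metric.infDist x (S \ {x}) → dist x y ≤ 101 / 100 * Metric.infDist x (S \ {x})) ∧ ∃ T : Finset (EuclideanSpace ℝ (Fin 3)), (↑T : Set (EuclideanSpace ℝ (Fin 3))) ⊆ {y : EuclideanSpace ℝ (Fin 3)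 | y ∈ S ∧ y ≠ x ∧ dist x y ≤ 101 / 100 * Metric.infDist x (S \ {x})} ∧ T.card = 12)) → (∀ x ∈ S, ∀ n : ℕ, ∃ A : EuclideanSpace ℝ (Fin 3) ≃ₗᵢ[ℝ] EuclideanSpace ℝ (Fin 3), ∃ t : ℝ, 0 < t ∧ ∃ F : Set (EuclideanSpace ℝ (Fin 3)), (F = (↑(Summit.AtomisticToContinuum.Crystallization.Theorems.PalmUnimodularRigidity.LayeredLawsSelectHcp.refStar a₀ h₀) : Set (EuclideanSpace ℝ (Fin 3))) ∨ F = ((fun p : EuclideanSpace ℝ (Fin 3) => a₀ • p) '' (↑Literature.Geometry.DiscreteGeometry.fccKissingPattern : Set (EuclideanSpace ℝ (Fin 3))))) ∧ (∀ y ∈ {y : EuclideanSpace ℝ (Fin 3) | y ∈ ((fun p : EuclideanSpace ℝ (Fin 3) => p - x) '' S) ∧ y ≠ 0 ∧ ‖y‖ ≤ 101 / 100 * Metric.infDist (0 : EuclideanSpace ℝ (Fin 3)) (((fun p : EuclideanSpace ℝ (Fin 3) => p - x) '' S) \ {0})}, ∃ v ∈ F, dist y (t • A v) ≤ 1 / ((n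 : ℝ) + 1) * t) ∧ (∀ v ∈ F, ∃ y ∈ {y : EuclideanSpace ℝ (Fin 3) | y ∈ ((fun p : EuclideanSpace ℝ (Fin 3) => p - x) '' S) ∧ y ≠ 0 ∧ ‖y‖ ≤ 101 / 100 * Metric.infDist (0 : EuclideanSpace ℝ (Fin 3)) (((fun p : EuclideanSpace ℝ (Fin 3) => p - x) '' S) \ {0})}, dist y (t • A v) ≤ 1 / ((n : ℝ) + 1) * t)) → ∃ t : ℝ, 0 < t ∧ ∃ S' : Set (EuclideanSpace ℝ (Fin 3)), S = (fun z : EuclideanSpace ℝ (Fin 3) => t • z) '' S' ∧ (0 : EuclideanSpace ℝ (Fin 3)) ∈ S' ∧ (∀ x ∈ S', ∃ A : EuclideanSpace ℝ (Fin 3) ≃ₗᵢ[ℝ] EuclideanSpace ℝ (Fin 3), ({y : EuclideanSpace ℝ (Fin 3) | y ∈ ((fun p : EuclideanSpace ℝ (Fin 3) => p - x) '' S') ∧ y ≠ 0 ∧ ‖y‖ ≤ 5 / 4} = A '' (↑(Summit.AtomisticToContinuum.Crystallization.Theorems.PalmUnimodularRigidity.LayeredLawsSelectHcp.refStar a₀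 h₀) : Set (EuclideanSpace ℝ (Fin 3))) ∨ {y : EuclideanSpace ℝ (Fin 3) | y ∈ ((fun p : EuclideanSpace ℝ (Fin 3) => p - x) '' S') ∧ y ≠ 0 ∧ ‖y‖ ≤ 5 / 4} = A '' ((fun p : EuclideanSpace ℝ (Fin 3) => a₀ • p) '' (↑Literature.Geometry.DiscreteGeometry.fccKissingPattern : Set (EuclideanSpace ℝ (Fin 3)))))) := by
  intro a h ha₁ ha₂ hh₁ hh₂ _hmin δ hδ S h0 hsep hgood hmatch
  have ha : 0 < a := by linarith
  -- Step 1: exact similar stars at every point (compactness)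
  have hexact : ∀ x ∈ S, ∃ A : EuclideanSpace ℝ (Fin 3) ≃ₗᵢ[ℝ] EuclideanSpace ℝ (Fin 3), ∃ t : ℝ,
      0 < t ∧ ∃ F : Set (EuclideanSpace ℝ (Fin 3)),
        (F = (refStar a h : Set (EuclideanSpace ℝ (Fin 3))) ∨
          F = (fun p : EuclideanSpace ℝ (Fin 3) => a • p) ''
            (fccKissingPattern : Set (EuclideanSpace ℝ (Fin 3)))) ∧
        {y : EuclideanSpace ℝ (Fin 3) | y ∈ ((fun p : EuclideanSpace ℝ (Fin 3) => p - x) '' S) ∧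
          y ≠ 0 ∧ ‖y‖ ≤ 101 / 100 * Metric.infDist (0 : EuclideanSpace ℝ (Fin 3))
            (((fun p : EuclideanSpace ℝ (Fin 3) => p - x) '' S) \ {0})} = (fun v => t • A v) '' F := by
    intro x hx
    set nn := Metric.infDist x (S \ {x}) with hnn_def
    have hnn : 0 < nn := infDist_pos hδ hsep hgood hx
    have htr := infDist_translate S x
    refine exact_of_matched_two (m := nn) (M := 101 / 100 * nn) (c := 9 / 10) (C := 5 / 4) ?_
      (finite_ref (a := a) (h := h) (Or.inl rfl)) (finite_ref (a := a) (h := h) (Or.inr rfl)) ?_ hnn (by norm_num) (by norm_num) ?_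
      (fun v hv => norm_bounds ha₁ ha₂ hh₁ hh₂ (Or.inl rfl) hv)
      (fun v hv => norm_bounds ha₁ ha₂ hh₁ hh₂ (Or.inr rfl) hv) (hmatch x hx)
    · -- the root star is finite
      refine ((Literature.Probability.Process.LocalConfig.finite_inter_of_separated hδ hsep
        (isCompact_closedBall x (101 / 100 * nn))).image
          (fun p : EuclideanSpace ℝ (Fin 3) => p - x)).subset ?_
      rintro y ⟨hy, hy0, hyn⟩
      rw [htr] at hyn
      rw [mem_translate_iff] at hy
      refine ⟨x + y, ⟨Metric.mem_closedBall.2 ?_, hy⟩, add_sub_cancel_left x y⟩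
      rwa [dist_eq_norm, add_sub_cancel_left]
    · -- and nonempty (a bond-shell neighbour)
      obtain ⟨-, -, Tx, hTx, hTxc⟩ := hgood x hx
      obtain ⟨p, hp⟩ := Finset.card_pos.1 (by rw [hTxc]; norm_num)
      obtain ⟨hpS, hpx, hd⟩ := hTx (Finset.mem_coe.2 hp)
      refine ⟨p - x, ⟨p, hpS, rfl⟩, sub_ne_zero.2 hpx, ?_⟩
      rwa [htr, ← dist_eq_norm, dist_comm]
    · -- norms of the root star lie in `[nn, 1.01 nn]`
      rintro y ⟨hy, hy0, hyn⟩
      rw [htr] at hyn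
      rw [mem_translate_iff] at hy
      refine ⟨?_, hyn⟩
      have hne : x + y ≠ x := fun heq => hy0 (by simpa using congrArg (fun w => w - x) heq)
      have := (le_infDist_of_sep hsep hx hy hne).2
      rwa [dist_comm, dist_eq_norm, add_sub_cancel_left] at this
  choose! A T hT F hF hR using hexact
  have hstar : ∀ x ∈ S, {y : EuclideanSpace ℝ (Fin 3) | y ∈ S ∧ y ≠ x ∧
      dist x y ≤ 101 / 100 * Metric.infDist x (S \ {x})} = (fun v => x + T x • A x v) '' F x :=
    fun x hx => bonded_eq_of_rootStar_eq (hR x hx)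
  -- Steps 2–3: one dilation, and the normalised set has exact absolute stars
  have hall : ∀ y ∈ S, y ∈ {z : EuclideanSpace ℝ (Fin 3) | Relation.ReflTransGen (fun p q : EuclideanSpace ℝ (Fin 3) =>
        p ∈ S ∧ q ∈ S ∧ q ≠ p ∧ dist p q ≤ 101 / 100 * Metric.infDist p (S \ {p})) 0 z} := fun y hy =>
    mem_bondComp ha₁ ha₂ hh₁ hh₂ hδ h0 hsep hgood hT hF hstar hy
  have hT0 : 0 < T 0 := hT 0 h0
  refine ⟨T 0, hT0, {w | T 0 • w ∈ {z : EuclideanSpace ℝ (Fin 3) | Relation.ReflTransGen (fun p q : EuclideanSpace ℝ (Fin 3) =>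
        p ∈ S ∧ q ∈ S ∧ q ≠ p ∧ dist p q ≤ 101 / 100 * Metric.infDist p (S \ {p})) 0 z}}, ?_, ?_, ?_⟩
  · ext y
    constructor
    · intro hy
      exact ⟨(T 0)⁻¹ • y, by
        show T 0 • ((T 0)⁻¹ • y) ∈ {z : EuclideanSpace ℝ (Fin 3) | Relation.ReflTransGen (fun p q : EuclideanSpace ℝ (Fin 3) =>
        p ∈ S ∧ q ∈ S ∧ q ≠ p ∧ dist p q ≤ 101 / 100 * Metric.infDist p (S \ {p})) 0 z}
        rw [smul_inv_smul₀ hT0.ne']; exact hall y hy, smul_inv_smul₀ hT0.ne' y⟩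
    · rintro ⟨w, hw, rfl⟩
      exact bondComp_subset h0 hw
  · show T 0 • (0 : EuclideanSpace ℝ (Fin 3)) ∈ {z : EuclideanSpace ℝ (Fin 3) | Relation.ReflTransGen (fun p q : EuclideanSpace ℝ (Fin 3) =>
        p ∈ S ∧ q ∈ S ∧ q ≠ p ∧ dist p q ≤ 101 / 100 * Metric.infDist p (S \ {p})) 0 z}
    rw [smul_zero]; exact Relation.ReflTransGen.refl
  · intro z hz
    have heq := pball_normalised_eq ha₁ ha₂ hh₁ hh₂ hδ h0 hsep hgood hT hF hstar hz
    refine ⟨A (T 0 • z), ?_⟩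
    rcases hF (T 0 • z) (bondComp_subset h0 hz) with hFz | hFz
    · left; rw [heq, hFz]
    · right; rw [heq, hFz]

end Summit.AtomisticToContinuum.Crystallization.Theorems.PricedHcpWindowsSimilarStarNormalisation

end
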